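import Summits.BirchSwinnertonDyer.BirchSwinnertonDyer.Theorems.PrintCf2SplitBadEisensteinTwoDescentTied
import Summits.BirchSwinnertonDyer.Rank1Residual.Additive.GordDescentExact
import HarnessLib

/-!
# Crux `PrintCf2.SplitBadTwoRankOneOfFacts` (item 20368), line `eisenstein_two_bdp_line` — the ODD-`p` CONTROL SOCKET IS OBSTRUCTED AT `2`:
# on a Heegner datum of a curve with `4 ∣ N`, «integral ♭-BDP frame + ♭-IMC equality + `SchneiderFree.AdditiveControlOnTreeAt 2`» CONTRADICTS the
# `K`-side `2`-part of BSD (cell bsd-p2's currency)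

Cell `bsd-print-cf2`, seat `bsd-line-cf2-p1-w2` (prover, width seat on crux stmt-BirchSwinnertonDyer-20368; lead `bsd-line-cf2-p1` g5, pen
bsd-idea-7). `--supports stmt-BirchSwinnertonDyer-20368` (helper). Theses-free; THEOREMS ONLY (0 definitions, 0 named facts, 0 `sorry`); CONDITIONAL on
`hL : LiuZhangZhang2018.thm151_thm153_modularCurve_heegnerVector_additive`. BSD is proved for no curve by any of this; nothing is refuted (no
registered statement is negated); no summit statement is proved by this seat.

WHAT THIS IS — a kernel-checked OBSTRUCTION for whoever types D2a. Cell bsd-schneider's torsion-robust derivation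
`SchneiderFreeAdditiveX3.additiveControlOnTreeAt_of_torsAtoms` (any `p`, «the exponents `g` and `t` CANCEL — the typed equality has no slack
and no torsion term») concludes the odd-`p` socket `SchneiderFree.AdditiveControlOnTreeAt p κ 𝔭 γ ι P` (`τ = 0`) from its atoms. THIS FILE:
**`not_additiveControlOnTreeAt_two_of_flatIMCEq_of_kSide`** — for `W/ℚ` globally minimal with `4 ∣ N_W`, a Heegner field `K` for `N_W` (so
`d_K ≡ 1 (mod 8)`), the Heegner point `P` (non-torsion, `rank E(K) = 1`), an anticyclotomic frame `(κ, γ)`, degree-one primes `𝔭 ≠ 𝔭′` above `2`,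
an embedding datum `ι′` inducing `𝔭` and an integral ♭-BDP frame `Q` of `Dt.f` at `𝔭` with the ♭-IMC EQUALITY at `𝔭′`: IF the `K`-side `2`-part
of BSD holds in cell bsd-p2's currency (`ord₂(4·I²/(c²·w_K²·c_K)) = ord₂ #Ш(E_K)`, i.e. `P2.MissingPPartOverAt (W.baseChange K) 2`), THEN
`¬ SchneiderFree.AdditiveControlOnTreeAt 2 κ 𝔭′ γ (embAt 𝔭′) P`. Equivalently: on such a datum the odd-`p` socket at `2` forces the `K`-side
identity to FAIL by exactly one unit (`2·ord₂ I = 2·ord₂ c + ord₂ c_K + ord₂ #Ш(E_K) − 1`). Hence, granted `BSD₂` over `K″` on the class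
(expected) and the line's stubs 1+2+3, at least one atom of `additiveControlOnTreeAt_of_torsAtoms` (as typed) fails at `p = 2` on
`49a1^{(d)}` — the (P6-add-tors) base count with «Castella's convention at `𝔭̄`» is the natural suspect (at `2`: `E₁(ℚ₂)/E₂(ℚ₂) ≅ 𝔽₂` and
`log_ω(E₂(ℚ₂)) = 4ℤ₂`, so the odd-`p` identity `log_ω(E(ℚ_p)⊗ℤ_p/tor) = p^{t_p − ord_p c_p}ℤ_p` acquires a `2`-adic correction, and
`#H¹(Γ, E(K_∞)[2^∞])` enters unsquared). This is the content of D2a's «net correction `+1`» (`PrintCf2SplitBadEisensteinTwoDescentCore`).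

References: [JetchevSkinnerWan2017] Thm. 3.3.1, Prop. 3.2.1; [Castella2018] Thm. 2.3; [LiuZhangZhang2018] Thm 1.5.1/1.5.3; [GrossZagier1986] V.(2.2);
[SilvermanAEC2009] IV.6.4 (b) (the formal logarithm at `p = 2`).
-/

set_option autoImplicit false

-- D-0017 layout: summit = sub-problem, so `Summit.BirchSwinnertonDyer.BirchSwinnertonDyer.…` is the mandated namespace of Theorems files.
set_option linter.dupNamespace false

noncomputable section

open scoped Classical MatrixGroups ModularForm Topology NumberField

namespace Summit.BirchSwinnertonDyer.BirchSwinnertonDyer.Theorems.PrintCf2.EisensteinTwo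

open Filter CongruenceSubgroup WeierstrassCurve NumberField IsDedekindDomain Field PowerSeries
  Literature.NumberTheory.EllipticCurves Literature.NumberTheory.EllipticCurves.ModularForms
  Literature.NumberTheory.EllipticCurves.LiuZhangZhang2018 Literature.NumberTheory.EllipticCurves.Rank1Residual
  Literature.NumberTheory.EllipticCurves.Rank1Residual.Typed Literature.NumberTheory.EllipticCurves.KrizLi2019
  Literature.NumberTheory.GaloisRepresentations Literature.NumberTheory.GaloisCohomology
  Summit.BirchSwinnertonDyer.Rank1Residual Summit.BirchSwinnertonDyer.Rank1Residual.X11b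
  Summit.BirchSwinnertonDyer.Rank1Residual.X11b.AcSelmer Summit.BirchSwinnertonDyer.Rank1Residual.X11b.CongruenceLimit
  Summit.BirchSwinnertonDyer.Rank1Residual.X11b.Halves Summit.BirchSwinnertonDyer.Rank1Residual.X2
  Summit.BirchSwinnertonDyer.Rank1Residual.Additive
  Summit.BirchSwinnertonDyer.BirchSwinnertonDyer.Theses.UniversalToricDescent
  Summit.BirchSwinnertonDyer.BirchSwinnertonDyer.Theorems.UniversalToricDescentWaldspurgerFlat

/-- **The odd-`p` control socket is OBSTRUCTED at `2` under the ♭-IMC equality and the `K`-side `2`-part of BSD.** Data: `W/ℚ` globally minimal,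
`4 ∣ N_W`; `K` imaginary quadratic with the Heegner hypothesis for `N_W`; the Heegner datum `(Dt, H, ι_K, P)`, `P` non-torsion, `rank E(K) = 1`
and `Ш(E_K)` finite (Kolyvagin, antecedents); `(κ, γ)` anticyclotomic at `2`; degree-one primes `𝔭`, `𝔭′` above `2`; `ι′` inducing `𝔭`; an integral
♭-BDP frame `(Ω_K, Ω_p, Q)` of `Dt.f` at `𝔭`; the ♭-IMC EQUALITY at `𝔭′` against `Q`; and the `K`-side identity
`ord₂ (4·[E(K):ℤP]²/(c²·w_K²·∏_w c_w(E_K))) = ord₂ #Ш(E_K)`. CONCLUSION: `¬ SchneiderFree.AdditiveControlOnTreeAt 2 κ 𝔭′ γ (embAt 𝔭′) P`.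
Proof: the core (`charExponent_eq_of_flatIMCEq_two`: `n = 1 + 2·padicLogOrd − 2·ord₂ c`) against the socket's `τ = 0` formula and
`not_kSideIdentity_of_correction_eq_zero` (`w_K = 2` from `d_K ≡ 1 (mod 8)`, split Tamagawa product = full one over a Heegner field).
CONDITIONAL on `hL`. [cite: JetchevSkinnerWan2017, Thm. 3.3.1 (arXiv:1512.06894 p. 11) (shape)] [cite: LiuZhangZhang2018, Thm 1.5.1 and Thm 1.5.3]
[cite: GrossZagier1986, V.(2.2)] -/
theorem not_additiveControlOnTreeAt_two_of_flatIMCEq_of_kSide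
    (hL : thm151_thm153_modularCurve_heegnerVector_additive)
    (W : WeierstrassCurve ℚ) [W.IsElliptic] [W.IsGloballyMinimal]
    (K : Type) [Field K] [NumberField K]
    (κ : ZpExtension K 2) (γ : absoluteGaloisGroup K) [Fact (κ.IsTopGenerator γ)] {N : ℕ} [NeZero N]
    (Dt : ModularParametrizationData W N) (H : HeegnerDatum N (NumberField.discr K))
    (ιK : K →+* ℂ) (P : (W.baseChange K).toAffine.Point)
    (hN : W.conductorNorm ℤ = N) (h4N : 2 ^ 2 ∣ N) (hK : IsImaginaryQuadratic K)
    (hHN : SatisfiesHeegnerHypothesis N K) (hκ : κ.IsAnticyclotomic)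
    (hP : WeierstrassCurve.Affine.Point.map ιK.toRatAlgHom P = heegnerPointComplex Dt H)
    (hPinf : ¬ IsOfFinAddOrder P) (hrk : (W.baseChange K).mordellWeilRank = 1) (hfinK : (W.baseChange K).ShaFinite)
    (𝔭 : HeightOneSpectrum (𝓞 K)) (h𝔭 : ((2 : ℕ) : 𝓞 K) ∈ 𝔭.asIdeal) (he : 𝔭.asIdeal.ramificationIdx (𝓞 ℚ) = 1)
    (hf : 𝔭.asIdeal.inertiaDeg (𝓞 ℚ) = 1)
    (𝔭' : HeightOneSpectrum (𝓞 K)) (h𝔭' : ((2 : ℕ) : 𝓞 K) ∈ 𝔭'.asIdeal) (he' : 𝔭'.asIdeal.ramificationIdx (𝓞 ℚ) = 1)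
    (hf' : 𝔭'.asIdeal.inertiaDeg (𝓞 ℚ) = 1)
    (ι' : PadicAlgCl 2 ≃+* ℂ) (hind : SchneiderFree.BranchInducesPrime 2 ι' 𝔭)
    {ΩK' : ℂ} {Ωp' : ℂ_[2]} {Q : PowerSeries (PadicComplexInt 2)} (hΩK' : ΩK' ≠ 0) (hΩp' : Ωp' ≠ 0)
    (hQ : R1.IsBDPLFunctionInt 2 ι' 𝔭 κ γ Dt.f ΩK' Ωp' Q)
    (hEq : (XAc.charIdeal (W.baseChange K) 2 κ 𝔭' ∅ γ).map (PowerSeries.map (R1.toCpInt 2)) = Ideal.span {Q})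
    (hkSide : padicValRat 2 (4 * ((AddSubgroup.zmultiples P).index : ℚ) ^ 2 /
        ((Dt.c : ℚ) ^ 2 * (Units.torsionOrder K : ℚ) ^ 2 * ((W.baseChange K).tamagawaProduct : ℚ))) =
      padicValNat 2 (W.baseChange K).shaOrder) :
    ¬ SchneiderFree.AdditiveControlOnTreeAt 2 κ 𝔭' γ (embAt K 2 𝔭' h𝔭' he' hf') P := by
  rintro ⟨n, hn, hnf⟩
  have h2N : (2 : ℕ) ∣ N := dvd_trans (dvd_pow_self 2 two_ne_zero) h4N
  -- `d_K ≡ 1 (mod 8)`, so `d_K < −4` and `w_K = 2`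
  have hd8 : NumberField.discr K % 8 = 1 := Literature.SatisfiesHeegnerHypothesis.discr_emod_eight hK.1 hHN h2N
  have hdneg : NumberField.discr K < 0 := IsImaginaryQuadratic.discr_neg hK
  have hd4 : NumberField.discr K < -4 := by omega
  have hw2 : Units.torsionOrder K = 2 :=
    Literature.NumberTheory.QuadraticFields.Quadratic.torsionOrder_eq_two_of_discr_lt_neg_four hK.1 hd4
  -- the core
  have hcore := charExponent_eq_of_flatIMCEq_two hL W K κ γ Dt H ιK P hN h4N hK hd4 hHN hκ hP hPinf hrk 𝔭 h𝔭 he hf 𝔭' h𝔭' he'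
    hf' ι' hind hΩK' hΩp' hQ hn hEq
  -- the `K`-side identity as an integer equation
  haveI : Finite (W.baseChange K).sha := hfinK
  set I : ℕ := (AddSubgroup.zmultiples P).index with hI_def
  have hheight := Summit.BirchSwinnertonDyer.Rank1Residual.P2.torsionOrder_sq_mul_canonicalHeight_eq_index_sq_mul_regulator
    (W.baseChange K) hrk P hPinf
  have htK : 0 < (W.baseChange K).torsionOrder := (W.baseChange K).torsionOrder_pos_holds
  have hI0 : I ≠ 0 := by
    intro hI
    rw [← hI_def, hI] at hheight
    have h0 : ((W.baseChange K).torsionOrder : ℝ) ^ 2 * P.canonicalHeight = 0 := by rw [hheight]; simp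
    rcases mul_eq_zero.mp h0 with h' | h'
    · exact absurd ((pow_eq_zero_iff two_ne_zero).mp h') (by exact_mod_cast htK.ne')
    · exact hPinf ((Affine.Point.canonicalHeight_eq_zero_iff_holds P).mp h')
  have hc0 : Dt.c ≠ 0 := Dt.maninConstant_ne_zero_holds
  have hcK : 0 < (W.baseChange K).tamagawaProduct := (W.baseChange K).tamagawaProduct_pos_holds
  have hIQ : (I : ℚ) ≠ 0 := by exact_mod_cast hI0
  have hcQ : (Dt.c : ℚ) ≠ 0 := by exact_mod_cast hc0
  have hwQ : (Units.torsionOrder K : ℚ) ≠ 0 := by rw [hw2]; norm_num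
  have hcKQ : ((W.baseChange K).tamagawaProduct : ℚ) ≠ 0 := by exact_mod_cast hcK.ne'
  have hsha : padicValNat 2 (Nat.card (AddCommGroup.primaryComponent (W.baseChange K).sha 2)) =
      padicValNat 2 (W.baseChange K).shaOrder :=
    Literature.NumberTheory.EllipticCurves.padicValNat_card_addPrimaryComponent 2
  have hcval : padicValRat 2 (Dt.c : ℚ) = (padicValNat 2 Dt.c.natAbs : ℤ) := by
    rw [padicValRat.of_int]; rfl
  have h2val : padicValRat 2 (((2 : ℕ) : ℚ)) = 1 := by
    rw [padicValRat.of_nat, padicValNat_self]; rfl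
  have h4val : padicValRat 2 (4 : ℚ) = 2 := by
    rw [show (4 : ℚ) = ((2 : ℕ) : ℚ) ^ 2 by norm_num, padicValRat.pow, h2val]; norm_num
  have hLHS : padicValRat 2 (4 * (I : ℚ) ^ 2 / ((Dt.c : ℚ) ^ 2 * (Units.torsionOrder K : ℚ) ^ 2 *
      ((W.baseChange K).tamagawaProduct : ℚ))) =
      2 + 2 * (padicValNat 2 I : ℤ) - (2 * (padicValNat 2 Dt.c.natAbs : ℤ) + 2 * 1 +
        (padicValNat 2 (W.baseChange K).tamagawaProduct : ℤ)) := by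
    rw [padicValRat.div (mul_ne_zero (by norm_num) (pow_ne_zero 2 hIQ))
        (mul_ne_zero (mul_ne_zero (pow_ne_zero 2 hcQ) (pow_ne_zero 2 hwQ)) hcKQ),
      padicValRat.mul (by norm_num) (pow_ne_zero 2 hIQ), padicValRat.mul (mul_ne_zero (pow_ne_zero 2 hcQ) (pow_ne_zero 2 hwQ)) hcKQ,
      padicValRat.mul (pow_ne_zero 2 hcQ) (pow_ne_zero 2 hwQ), padicValRat.pow, padicValRat.pow, padicValRat.pow, h4val, hw2, hcval,
      h2val, padicValRat.of_nat, padicValRat.of_nat]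
    push_cast
    ring
  rw [hLHS, ← hsha] at hkSide
  -- the socket's split Tamagawa product is the full one over a Heegner field
  rw [X11b.padicValNat_tamagawaProductSplit_eq_of_heegner_prime W K 2 hN hHN] at hnf
  -- `τ = 0` is incompatible with the `K`-side identity under the core
  have hctl : (n : ℤ) = (padicValNat 2 (Nat.card (AddCommGroup.primaryComponent (W.baseChange K).sha 2)) : ℤ) +
      2 * (X11b.padicLogOrd W 2 (embAt K 2 𝔭' h𝔭' he' hf') P - (padicValNat 2 I : ℤ)) +
      (padicValNat 2 (W.baseChange K).tamagawaProduct : ℤ) + 0 := by rw [add_zero]; exact hnf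
  exact not_kSideIdentity_of_correction_eq_zero hctl hcore (by linarith [hkSide])

/-- **Same obstruction, with the `K`-side identity supplied by `BSD₂(W)`, `BSD₂` of the twist and Milne 1972** (cell bsd-p2's identity (★)
`#Ш_an(E_K)·#Ш(W)·#Ш(Wd) = #Ш_an(W)·#Ш_an(Wd)·#Ш(E_K)` read at `2`: `P2.missingPPartOverAt_of_bsdp_of_bsdp_twist`-direction, here taken through
`P2.missingPPartOverAt_baseChange_iff_of_heegner`): IF `BSD₂` holds for `W` and for a globally minimal model of `W^{(d_K)}` (as the crux and the
line's twin socket predict) and Milne's Weil-restriction identity holds, then on every datum as above the odd-`p` socket at `2` FAILS. So the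
pen's D2a cannot be the odd-`p` formula; its net correction is `+1` (`PrintCf2SplitBadEisensteinTwoDescentCore`).
[cite: Milne1972ArithmeticAV, §1 Thm. 1] [cite: GrossZagier1986, V.(2.2)] [cite: Miller2011LMS, Def. 1.1] -/
theorem not_additiveControlOnTreeAt_two_of_flatIMCEq_of_bsdp
    (hL : thm151_thm153_modularCurve_heegnerVector_additive) (hF : ToricPublishedInputs)
    (hMilne : Milne1972.bsdQuotient_baseChange_quadratic)
    (W : WeierstrassCurve ℚ) [W.IsElliptic] [W.IsGloballyMinimal]
    (K : Type) [Field K] [NumberField K]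
    (κ : ZpExtension K 2) (γ : absoluteGaloisGroup K) [Fact (κ.IsTopGenerator γ)] {N : ℕ} [NeZero N]
    (Dt : ModularParametrizationData W N) (H : HeegnerDatum N (NumberField.discr K))
    (ιK : K →+* ℂ) (P : (W.baseChange K).toAffine.Point)
    (hN : W.conductorNorm ℤ = N) (h4N : 2 ^ 2 ∣ N) (hK : IsImaginaryQuadratic K)
    (hHN : SatisfiesHeegnerHypothesis N K) (hκ : κ.IsAnticyclotomic)
    (hP : WeierstrassCurve.Affine.Point.map ιK.toRatAlgHom P = heegnerPointComplex Dt H)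
    (hr : W.analyticRank = 1) (hLt : (W.quadraticTwist (NumberField.discr K : ℚ)).entireLFunction 1 ≠ 0)
    (Wd : WeierstrassCurve ℚ) [Wd.IsElliptic] [Wd.IsGloballyMinimal]
    (hWd : ∃ C : VariableChange ℚ, C • W.quadraticTwist (NumberField.discr K : ℚ) = Wd)
    (hBSD : BSDp W 2) (hBSDd : BSDp Wd 2)
    (𝔭 : HeightOneSpectrum (𝓞 K)) (h𝔭 : ((2 : ℕ) : 𝓞 K) ∈ 𝔭.asIdeal) (he : 𝔭.asIdeal.ramificationIdx (𝓞 ℚ) = 1)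
    (hf : 𝔭.asIdeal.inertiaDeg (𝓞 ℚ) = 1)
    (𝔭' : HeightOneSpectrum (𝓞 K)) (h𝔭' : ((2 : ℕ) : 𝓞 K) ∈ 𝔭'.asIdeal) (he' : 𝔭'.asIdeal.ramificationIdx (𝓞 ℚ) = 1)
    (hf' : 𝔭'.asIdeal.inertiaDeg (𝓞 ℚ) = 1)
    (ι' : PadicAlgCl 2 ≃+* ℂ) (hind : SchneiderFree.BranchInducesPrime 2 ι' 𝔭)
    {ΩK' : ℂ} {Ωp' : ℂ_[2]} {Q : PowerSeries (PadicComplexInt 2)} (hΩK' : ΩK' ≠ 0) (hΩp' : Ωp' ≠ 0)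
    (hQ : R1.IsBDPLFunctionInt 2 ι' 𝔭 κ γ Dt.f ΩK' Ωp' Q)
    (hEq : (XAc.charIdeal (W.baseChange K) 2 κ 𝔭' ∅ γ).map (PowerSeries.map (R1.toCpInt 2)) = Ideal.span {Q}) :
    ¬ SchneiderFree.AdditiveControlOnTreeAt 2 κ 𝔭' γ (embAt K 2 𝔭' h𝔭' he' hf') P := by
  obtain ⟨hGZ, hKo, hGZK, hmod, -, -, -, -, -, -⟩ := hF
  have h2 : Module.finrank ℚ K = 2 := hK.1
  -- non-torsion and Kolyvagin
  have hL0 : W.entireLFunction 1 = 0 := entireLFunction_one_eq_zero_of_analyticRank_eq_one hr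
  obtain ⟨-, hderiv⟩ := leadingLCoeff_eq_deriv_of_analyticRank_eq_one hr
  have hLK : LDerivEK W K ≠ 0 := by
    rw [lDerivEK_eq_deriv_mul W K hmod hL0]; exact mul_ne_zero hderiv hLt
  have hPinf : ¬ IsOfFinAddOrder P :=
    (lDerivEK_ne_zero_iff_not_isOfFinAddOrder W N K (hGZ _ W K) hK hHN ⟨Dt, H, ιK, hP⟩).mp hLK
  obtain ⟨hrk, hfinK⟩ := (hKo N W K) hK hHN ⟨Dt, H, ιK, hP⟩ hPinf
  have hc0 : Dt.c ≠ 0 := Dt.maninConstant_ne_zero_holds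
  -- `E_K` globally minimal, analytic rank one over `K`
  haveI : (W.baseChange K).IsGloballyMinimal := W.isGloballyMinimal_baseChange_of_satisfiesHeegnerHypothesis K h2 (hN ▸ hHN)
  have hD0 : (NumberField.discr K : ℚ) ≠ 0 := by exact_mod_cast NumberField.discr_ne_zero K
  haveI hEt : (W.quadraticTwist (NumberField.discr K : ℚ)).IsElliptic := W.isElliptic_quadraticTwist hD0
  have hrK : (W.baseChange K).analyticRank = 1 :=
    (Summit.BirchSwinnertonDyer.Rank1Residual.P2.analyticRank_baseChange_eq_one_iff W K hmod h2).mpr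
      (Or.inl ⟨hr, ((W.quadraticTwist (NumberField.discr K : ℚ)).analyticRank_eq_zero_iff_holds (hmod _)).mpr hLt⟩)
  have hrd : Wd.analyticRank ≤ 1 := by
    obtain ⟨Cd, hCd⟩ := hWd
    rw [← hCd, analyticRank_smul, ((W.quadraticTwist (NumberField.discr K : ℚ)).analyticRank_eq_zero_iff_holds (hmod _)).mpr hLt]
    exact zero_le_one
  -- the `K`-side input from `BSD₂(W)`, `BSD₂(Wd)`, Milne
  have hKside : Summit.BirchSwinnertonDyer.Rank1Residual.AdditivePotMult.MissingPPartOverAt (W.baseChange K) 2 :=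
    Summit.BirchSwinnertonDyer.Rank1Residual.Additive.pPartOver_of_bsdp_of_bsdp_twist W 2 K Wd (W.baseChange K) hGZK
      hmod hMilne (by rw [hr]) h2 hWd hrd ⟨1, one_smul _ _⟩ hBSD hBSDd
  have hkSide := (Summit.BirchSwinnertonDyer.Rank1Residual.P2.missingPPartOverAt_baseChange_iff_of_heegner W N K Dt H ιK P 2
    (hGZ _ W K) (hKo N W K) hmod hK hHN hP hc0 hrK).mp hKside
  exact not_additiveControlOnTreeAt_two_of_flatIMCEq_of_kSide hL W K κ γ Dt H ιK P hN h4N hK hHN hκ hP hPinf hrk hfinK 𝔭 h𝔭 he hf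
    𝔭' h𝔭' he' hf' ι' hind hΩK' hΩp' hQ hEq hkSide

end Summit.BirchSwinnertonDyer.BirchSwinnertonDyer.Theorems.PrintCf2.EisensteinTwo

end
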